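import Literature.AnabelianGeometry.EtaleTheta.FrobenioidThetaTowerOfBiKummerFamily
import Literature.AnabelianGeometry.EtaleTheta.Discharge.Sec5Thm57Descent

/-!
# [EtTh] §5, Theorem 5.7 at ALL levels for the ASSEMBLED tower: the unit law along `β_{1,N}` (Rmk. 4.3.2, p. 319 / PDF p. 93)

Mochizuki, *The étale theta function …*, Publ. RIMS **45** (2009)
[cite: MochizukiEtTh2009, Rmk 4.3.2 p.319 (PDF p.93); Lem 5.8 p.331 (PDF p.105)]; *The geometry of Frobenioids I*
[cite: MochizukiFrdI2008, Thm. 5.2 (i) p.100].  Seat abc-iut-L2-d4 (node `EtTh:Thm5.7`, GAP row G-L2d4-3 part `hconst`);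
PROOF-ONLY over abc-iut-L2-t4's `FrobenioidThetaTowerOfBiKummerFamily.lean` (p420398: the §5 tower ASSEMBLED from a family
of roots, `ThetaFrobenioidTower.ofBiKummerFamily`) and this seat's `Discharge/Sec5Thm57Descent.lean` (p417811), whose
hypothesis `hconst` — the [FrdI] unit law along the Frobenius-degree-`N` isometry `β_{1,N}` FUSED with the naturality of the
constants `K^× ↪ O^×(B_N^birat)` — is here DERIVED for the assembled tower from abc-iut-L1's composition law of the model
Frobenioid ([FrdI] Thm. 5.2 (i): `u_{ψ∘φ} = B(Base φ)(u_ψ) · u_φ^{deg_Fr ψ}`, `ModelFrobenioid.unit_comp`): if the units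
`u ∈ O^×(B_N)`, `u_1 ∈ O^×(B_1)` satisfy `u ≫ β_{1,N} = β_{1,N} ≫ u_1`, then `u_u^N = B(β_{1,N}^bs)(u_{u_1})` in
`B(B_N^bs) = O^×(B_N^birat)` (`unit_pow_eq_pull_of_comm`; "`β_{N,N'}` is an isometry of Frobenius degree `N'/N`", Rmk. 4.3.2
p.319 (PDF p.93)).  What remains of `hconst` is EXACTLY the naturality of the per-level constants along `β_{1,N}`
(`hnat : B(β_{1,N}^bs)(ι_1(c)) = ι_N(c)`, "the natural inclusion `K^× ↪ O^×(B_N^birat)`", Lem. 5.8 p.331 (PDF p.105)) — the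
tower's constants `constEmb N` being free inputs (abc-iut-L6-t23 audit note (T-a)), it is an explicit hypothesis
(`hconst_ofBiKummerFamily`).
HONEST FRAMING: kernel-checked consequences for data so constructed; nothing asserts that such data exist for an actual curve;
typed ≠ discharged; no side taken on anything downstream. -/

noncomputable section

namespace Literature.AnabelianGeometry.EtaleTheta

open CategoryTheory Opposite Literature.AlgebraicGeometry.Frobenioids

universe u₀ v₀ u v w

/-! ### The [FrdI] Thm. 5.2 (i) unit law for commuting units along a morphism of the model Frobenioid -/

section ModelUnitLaw

variable {D : Type u} [Category.{v} D] {Φ B : Dᵒᵖ ⥤ CommMonCat.{w}} {DivB : B ⟶ monoidGp Φ}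

/-- **Units commuting along a morphism of the model Frobenioid**: for `β : X → Y`, `u ∈ O^×(X)`, `u_1 ∈ O^×(Y)` with
`u ≫ β = β ≫ u_1`, the unit components satisfy `u_β · u_u^{deg_Fr β} = B(Base β)(u_{u_1}) · u_β` — read off
`u_{ψ∘φ} = B(Base φ)(u_ψ) · u_φ^{deg_Fr ψ}` ([FrdI] Thm. 5.2 (i)) on both sides (`Base u = id`, `deg_Fr u_1 = 1`).
[cite: MochizukiFrdI2008, Thm. 5.2 (i) p.100] -/
theorem unit_mul_unit_pow_eq_of_comm {X Y : ModelFrobenioid Φ B DivB} (β : X ⟶ Y) {u : Aut X} {u₁ : Aut Y}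
    (hu : u ∈ ModelFrobenioid.units X) (hu₁ : u₁ ∈ ModelFrobenioid.units Y) (hcomm : u.hom ≫ β = β ≫ u₁.hom) :
    ModelFrobenioid.unit β * ModelFrobenioid.unit u.hom ^ (ModelFrobenioid.degFr β : ℕ) =
      (B.map (ModelFrobenioid.baseMap β).op).hom (ModelFrobenioid.unit u₁.hom) * ModelFrobenioid.unit β := by
  have h := congrArg ModelFrobenioid.unit hcomm
  rw [ModelFrobenioid.unit_comp, ModelFrobenioid.unit_comp, hu.1, hu₁.2, PNat.one_coe, pow_one,
    ModelFrobenioid.map_id_apply_B] at h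
  exact h

/-- **The unit law along a morphism of Frobenius degree `d`** (cancelling `u_β`, `B` group-like — [FrdI] Thm. 5.2 standing
hypothesis): `u_u^{deg_Fr β} = B(Base β)(u_{u_1})`.  For `β = β_{1,N}` ("an isometry of Frobenius degree `N'/N`", [EtTh]
Rmk. 4.3.2 p.319 (PDF p.93)) this is `u_N^N = β_{1,N}^*(u_1)` in `O^×(B_N^birat)`.
[cite: MochizukiFrdI2008, Thm. 5.2 (i) p.100] -/
theorem unit_pow_eq_pull_of_comm (hB : Objectwise (fun M _ => IsGroupLike M) B) {X Y : ModelFrobenioid Φ B DivB}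
    (β : X ⟶ Y) {u : Aut X} {u₁ : Aut Y} (hu : u ∈ ModelFrobenioid.units X) (hu₁ : u₁ ∈ ModelFrobenioid.units Y)
    (hcomm : u.hom ≫ β = β ≫ u₁.hom) :
    ModelFrobenioid.unit u.hom ^ (ModelFrobenioid.degFr β : ℕ) =
      (B.map (ModelFrobenioid.baseMap β).op).hom (ModelFrobenioid.unit u₁.hom) := by
  have h := unit_mul_unit_pow_eq_of_comm β hu hu₁ hcomm
  rw [mul_comm _ (ModelFrobenioid.unit β)] at h
  exact ((hB X.base).isUnit (ModelFrobenioid.unit β)).mul_left_cancel h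

end ModelUnitLaw

/-! ### `hconst` for the assembled tower, modulo the naturality of the constants -/

namespace ThetaFrobenioidTower

variable {K : Type u₀} [Field K] {X : SemiGraphs.TemperedArithmeticGroup.{u₀} K} {D₀ : Type u₀} [Category.{v₀} D₀]
  {V : FrdIMonoidStub.{w}} {T₀ : RealifiedDivisorMonoids (D₀ := D₀) V} {D : Type u} [Category.{v} D]
  {VD : FrdICatStub.{u, v, w} D} {S : BiKummerSetting X T₀ D VD}
  {pullFrac : ∀ {A A' : S.C} (_ : A' ⟶ A), S.biratUnits A → S.biratUnits A'}
  {lv : ℕ+} {E : Set ℕ+} {𝒯 : ThetaEnvTower.{max v w} E} {θ : S.biratUnits S.Aodot} {Bl : S.C}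
  {Pl : S.FractionPair θ Bl} {Rl : S.NthRoot θ Pl lv pullFrac}
  (h : ModelFrobenioid.Hypotheses S.tf.divisorMonoid S.tf.ratFnFunctor)
  (toB : ∀ A : S.C, S.biratUnits A →* S.tf.biratUnitsModel A) (Q : FrobenioidTheta.ThetaSubquotientStub.{w} D)
  (odd_l : Odd (lv : ℕ)) (R : ∀ N : ℕ+, S.NthRoot Rl.root Rl.pair N pullFrac) (ιX : 𝒯.PiX ≃ₜ* X.Pi)
  (hopen : ∀ N : ℕ+, IsOpen ((S.galoisSurj (R N).AN.base (R N).αData.isGalois).ker : Set X.Pi))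
  (σ : ∀ N : ℕ+, Aut (R N).AN.base →* Aut (R N).AN)
  (K' : Type w) [Field K'] (constEmb : ∀ N : ℕ+, K'ˣ →* S.tf.biratUnitsModel (R N).BN)
  (constEmb_injective : ∀ N : ℕ+, Function.Injective (constEmb N))
  (hdivc : ∀ (N : ℕ+) (g : Aut (R N).BN.base),
    ModelFrobenioid.div ((σ N ((BiKummerSetting.NthRoot.baseIso S (R N)).conjAut.symm g)).hom ≫ (R N).pair.num) =
      ModelFrobenioid.div (R N).pair.num)
  (hdivp : ∀ (N : ℕ+) (y : 𝒯.PiYdd),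
    ModelFrobenioid.div ((σ N (S.galoisSurj (R N).AN.base (R N).αData.isGalois (ιX y.1))).hom ≫ (R N).pair.den) =
      ModelFrobenioid.div (R N).pair.den)
  (α : ∀ {N N' : ℕ+}, (N : ℕ) ∣ N' → ((R N').AN ⟶ (R N).AN))
  (β : ∀ {N N' : ℕ+}, (N : ℕ) ∣ N' → ((R N').BN ⟶ (R N).BN))
  (comm_sCap : ∀ {N N' : ℕ+} (hd : (N : ℕ) ∣ N'), (R N').pair.num ≫ β hd = α hd ≫ (R N).pair.num)
  (comm_sCup : ∀ {N N' : ℕ+} (hd : (N : ℕ) ∣ N'), (R N').pair.den ≫ β hd = α hd ≫ (R N).pair.den)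
  (isIsometry_α : ∀ {N N' : ℕ+} (hd : (N : ℕ) ∣ N'), (S.sec5Stub h).pre.IsIsometry (α hd))
  (degFr_α : ∀ {N N' : ℕ+} (hd : (N : ℕ) ∣ N'), ((S.sec5Stub h).pre.degFr (α hd) : ℕ) * N = N')
  (isIsometry_β : ∀ {N N' : ℕ+} (hd : (N : ℕ) ∣ N'), (S.sec5Stub h).pre.IsIsometry (β hd))
  (degFr_β : ∀ {N N' : ℕ+} (hd : (N : ℕ) ∣ N'), ((S.sec5Stub h).pre.degFr (β hd) : ℕ) * N = N')
  (baseFrob_α : ∀ {N N' : ℕ+} (hd : (N : ℕ) ∣ N'), S.IsOfBaseFrobeniusType (α hd))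
  (ρ_comm_β : ∀ {N N' : ℕ+} (hd : (N : ℕ) ∣ N'), ∃ x : 𝒯.PiX, ∀ g : 𝒯.PiX,
    (rhoFamily R ιX N' g).hom ≫ ModelFrobenioid.baseMap (β hd) =
      ModelFrobenioid.baseMap (β hd) ≫ (rhoFamily R ιX N (x * g * x⁻¹)).hom)

/-- **The hypothesis `hconst` of `thetaRootPreservedAll_of_levelOne` HOLDS for the assembled tower, modulo the
naturality of the constants along `β_{1,N}`.**  For `𝔗 := ofBiKummerFamily …`, units `u ∈ O^×(B_N)`, `u_1 ∈ O^×(B_1)` with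
`u ≫ β_{1,N} = β_{1,N} ≫ u_1` and `u_1 =` the constant `c` at level `1`, one has `u^N =` the constant `c` at level `N` in
`O^×(B_N^birat)` — from `unit_pow_eq_pull_of_comm` ([FrdI] Thm. 5.2 (i); `deg_Fr β_{1,N} = N`, Rmk. 4.3.2) and the
naturality input `hnat : B(β_{1,N}^bs)(ι_1(c)) = ι_N(c)` ("the natural inclusion `K^× ↪ O^×(B_N^birat)`", Lem. 5.8 p.331
(PDF p.105)).  [cite: MochizukiEtTh2009, Rmk 4.3.2 p.319 (PDF p.93); Lem 5.8 p.331 (PDF p.105)] -/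
theorem hconst_ofBiKummerFamily
    (hnat : ∀ (N : ℕ+) (c : K'ˣ),
      (S.tf.ratFnFunctor.map (ModelFrobenioid.baseMap (β (one_dvd_level N))).op).hom
          ((constEmb 1 c : S.tf.biratUnitsModel (R 1).BN) : S.tf.ratFnFunctor.obj (op (R 1).BN.base)) =
        ((constEmb N c : S.tf.biratUnitsModel (R N).BN) : S.tf.ratFnFunctor.obj (op (R N).BN.base)))
    (N : ℕ+) (u : Aut (R N).BN)
    (hu : u ∈ ((ofBiKummerFamily h toB Q odd_l R ιX hopen σ K' constEmb constEmb_injective hdivc hdivp α β comm_sCap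
      comm_sCup isIsometry_α degFr_α isIsometry_β degFr_β baseFrob_α ρ_comm_β).atLevel N).units (R N).BN)
    (u₁ : Aut (R 1).BN)
    (hu₁ : u₁ ∈ ((ofBiKummerFamily h toB Q odd_l R ιX hopen σ K' constEmb constEmb_injective hdivc hdivp α β comm_sCap
      comm_sCup isIsometry_α degFr_α isIsometry_β degFr_β baseFrob_α ρ_comm_β).atLevel 1).units (R 1).BN)
    (c : K'ˣ) (hcomm : u.hom ≫ β (one_dvd_level N) = β (one_dvd_level N) ≫ u₁.hom)
    (h₁ : ((ofBiKummerFamily h toB Q odd_l R ιX hopen σ K' constEmb constEmb_injective hdivc hdivp α β comm_sCap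
      comm_sCup isIsometry_α degFr_α isIsometry_β degFr_β baseFrob_α ρ_comm_β).atLevel 1).unitsToBirat (R 1).BN
        ⟨u₁, hu₁⟩ = constEmb 1 c) :
    ((ofBiKummerFamily h toB Q odd_l R ιX hopen σ K' constEmb constEmb_injective hdivc hdivp α β comm_sCap
      comm_sCup isIsometry_α degFr_α isIsometry_β degFr_β baseFrob_α ρ_comm_β).atLevel N).unitsToBirat (R N).BN
        ⟨u, hu⟩ ^ (N : ℕ) = constEmb N c := by
  -- `deg_Fr β_{1,N} = N`
  have hdeg : (ModelFrobenioid.degFr (β (one_dvd_level N)) : ℕ) = N := by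
    have := degFr_β (one_dvd_level N)
    rw [PNat.one_coe, mul_one] at this
    exact this
  -- the level-1 constant, on values: `u_{u_1} = ι_1(c)`
  have h₁' : ModelFrobenioid.unit u₁.hom =
      ((constEmb 1 c : S.tf.biratUnitsModel (R 1).BN) : S.tf.ratFnFunctor.obj (op (R 1).BN.base)) := by
    have := congrArg (fun x : S.tf.biratUnitsModel (R 1).BN => (x : S.tf.ratFnFunctor.obj (op (R 1).BN.base)))
      (show (show S.tf.biratUnitsModel (R 1).BN from
        ((ofBiKummerFamily h toB Q odd_l R ιX hopen σ K' constEmb constEmb_injective hdivc hdivp α β comm_sCap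
          comm_sCup isIsometry_α degFr_α isIsometry_β degFr_β baseFrob_α ρ_comm_β).atLevel 1).unitsToBirat (R 1).BN
            ⟨u₁, hu₁⟩) = constEmb 1 c from h₁)
    exact this
  apply Units.ext
  change ModelFrobenioid.unit u.hom ^ (N : ℕ) =
    ((constEmb N c : S.tf.biratUnitsModel (R N).BN) : S.tf.ratFnFunctor.obj (op (R N).BN.base))
  rw [← hnat N c, ← h₁', ← hdeg]
  exact unit_pow_eq_pull_of_comm h.isGroupLike_rat (β (one_dvd_level N)) hu hu₁ hcomm


/-- The same in the EXACT binder shape `hconst` of `thetaRootPreservedAll_of_levelOne` / `…_of_constTorsion` (all objects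
read through the tower's own projections `𝔗.BN`, `𝔗.β`, `𝔗.constEmb`).
[cite: MochizukiEtTh2009, Rmk 4.3.2 p.319 (PDF p.93); Lem 5.8 p.331 (PDF p.105)] -/
theorem hconst_ofBiKummerFamily'
    (hnat : ∀ (N : ℕ+) (c : K'ˣ),
      (S.tf.ratFnFunctor.map (ModelFrobenioid.baseMap (β (one_dvd_level N))).op).hom
          ((constEmb 1 c : S.tf.biratUnitsModel (R 1).BN) : S.tf.ratFnFunctor.obj (op (R 1).BN.base)) =
        ((constEmb N c : S.tf.biratUnitsModel (R N).BN) : S.tf.ratFnFunctor.obj (op (R N).BN.base))) :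
    ∀ (N : ℕ+) (u : Aut ((ofBiKummerFamily h toB Q odd_l R ιX hopen σ K' constEmb constEmb_injective hdivc hdivp α β comm_sCap
      comm_sCup isIsometry_α degFr_α isIsometry_β degFr_β baseFrob_α ρ_comm_β).BN N))
      (hu : u ∈ ((ofBiKummerFamily h toB Q odd_l R ιX hopen σ K' constEmb constEmb_injective hdivc hdivp α β comm_sCap
      comm_sCup isIsometry_α degFr_α isIsometry_β degFr_β baseFrob_α ρ_comm_β).atLevel N).units ((ofBiKummerFamily h toB Q odd_l R ιX hopen σ K' constEmb constEmb_injective hdivc hdivp α β comm_sCap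
      comm_sCup isIsometry_α degFr_α isIsometry_β degFr_β baseFrob_α ρ_comm_β).BN N))
      (u₁ : Aut ((ofBiKummerFamily h toB Q odd_l R ιX hopen σ K' constEmb constEmb_injective hdivc hdivp α β comm_sCap
      comm_sCup isIsometry_α degFr_α isIsometry_β degFr_β baseFrob_α ρ_comm_β).BN 1))
      (hu₁ : u₁ ∈ ((ofBiKummerFamily h toB Q odd_l R ιX hopen σ K' constEmb constEmb_injective hdivc hdivp α β comm_sCap
      comm_sCup isIsometry_α degFr_α isIsometry_β degFr_β baseFrob_α ρ_comm_β).atLevel 1).units ((ofBiKummerFamily h toB Q odd_l R ιX hopen σ K' constEmb constEmb_injective hdivc hdivp α β comm_sCap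
      comm_sCup isIsometry_α degFr_α isIsometry_β degFr_β baseFrob_α ρ_comm_β).BN 1))
      (c : (ofBiKummerFamily h toB Q odd_l R ιX hopen σ K' constEmb constEmb_injective hdivc hdivp α β comm_sCap
      comm_sCup isIsometry_α degFr_α isIsometry_β degFr_β baseFrob_α ρ_comm_β).Kˣ),
      u.hom ≫ (ofBiKummerFamily h toB Q odd_l R ιX hopen σ K' constEmb constEmb_injective hdivc hdivp α β comm_sCap
      comm_sCup isIsometry_α degFr_α isIsometry_β degFr_β baseFrob_α ρ_comm_β).β (one_dvd_level N) = (ofBiKummerFamily h toB Q odd_l R ιX hopen σ K' constEmb constEmb_injective hdivc hdivp α β comm_sCap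
      comm_sCup isIsometry_α degFr_α isIsometry_β degFr_β baseFrob_α ρ_comm_β).β (one_dvd_level N) ≫ u₁.hom →
      ((ofBiKummerFamily h toB Q odd_l R ιX hopen σ K' constEmb constEmb_injective hdivc hdivp α β comm_sCap
      comm_sCup isIsometry_α degFr_α isIsometry_β degFr_β baseFrob_α ρ_comm_β).atLevel 1).unitsToBirat ((ofBiKummerFamily h toB Q odd_l R ιX hopen σ K' constEmb constEmb_injective hdivc hdivp α β comm_sCap
      comm_sCup isIsometry_α degFr_α isIsometry_β degFr_β baseFrob_α ρ_comm_β).BN 1) ⟨u₁, hu₁⟩ = (ofBiKummerFamily h toB Q odd_l R ιX hopen σ K' constEmb constEmb_injective hdivc hdivp α β comm_sCap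
      comm_sCup isIsometry_α degFr_α isIsometry_β degFr_β baseFrob_α ρ_comm_β).constEmb 1 c →
        ((ofBiKummerFamily h toB Q odd_l R ιX hopen σ K' constEmb constEmb_injective hdivc hdivp α β comm_sCap
      comm_sCup isIsometry_α degFr_α isIsometry_β degFr_β baseFrob_α ρ_comm_β).atLevel N).unitsToBirat ((ofBiKummerFamily h toB Q odd_l R ιX hopen σ K' constEmb constEmb_injective hdivc hdivp α β comm_sCap
      comm_sCup isIsometry_α degFr_α isIsometry_β degFr_β baseFrob_α ρ_comm_β).BN N) ⟨u, hu⟩ ^ (N : ℕ) = (ofBiKummerFamily h toB Q odd_l R ιX hopen σ K' constEmb constEmb_injective hdivc hdivp α β comm_sCap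
      comm_sCup isIsometry_α degFr_α isIsometry_β degFr_β baseFrob_α ρ_comm_β).constEmb N c :=
  fun N u hu u₁ hu₁ c hcomm h₁ =>
    hconst_ofBiKummerFamily h toB Q odd_l R ιX hopen σ K' constEmb constEmb_injective hdivc hdivp α β comm_sCap
      comm_sCup isIsometry_α degFr_α isIsometry_β degFr_β baseFrob_α ρ_comm_β hnat N u hu u₁ hu₁ c hcomm h₁

end ThetaFrobenioidTower

end Literature.AnabelianGeometry.EtaleTheta

end
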